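import Summits.AtomisticToContinuum.Crystallization.Cruxes.MinimiserShells.IdeatorFourSketch

/-!
# Triage r2-2 scratch: `IdeatorFour.EquilibriumLocalisation` is vacuously TRUE as typed

Card `equilibrium-liouville-localisation` (crux stmt-AtomisticToContinuum-9225), first deterministic lemma
`EquilibriumLocalisation` (tree `Cruxes/MinimiserShells/IdeatorFourSketch.lean`): its second disjunct asks for SOME
continuous linear map `A` and SOME Hägg word `s` such that every point of the `R`-ball around `x` is within `1/200`
of `A '' barlowStacking 1 √(2/3) s`.  Nothing ties `A` to an isometry (or to a bijection with the ball), so the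
contraction `A = (1/160) • id` works for EVERY configuration: the fcc stacking (`constHagg`) has covering radius
`≤ √(1/4 + 3/16 + 1/6) = √(29/48) < 4/5` by coordinatewise rounding (`cover_fcc`), hence its `1/160`-scaled copy is
`1/200`-dense in `ℝ³`.  So the typed statement carries no information; the intended statement needs `A` within a
fixed distance of `O(3)` (and a bijective chart).  Sorry-free; axioms standard.
-/

noncomputable section

open Literature.MathematicalPhysics.StatisticalMechanics
open Summit.AtomisticToContinuum.Crystallization.Cruxes.MinimiserShells.IdeatorFour

namespace TriageR22

/-- Covering radius of the fcc Barlow stacking with unit in-layer spacing and layer spacing `√(2/3)`: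
every point of `ℝ³` is within `4/5` of a stacking point (coordinatewise rounding: layer, row, column). -/
theorem cover_fcc (w : E3) :
    ∃ k i j : ℤ, dist w (barlowPos 1 (Real.sqrt (2 / 3)) constHagg k i j) ≤ 4 / 5 := by
  set hh : ℝ := Real.sqrt (2 / 3) with hhh
  have hh_pos : 0 < hh := Real.sqrt_pos.mpr (by norm_num)
  have hh_sq : hh ^ 2 = 2 / 3 := Real.sq_sqrt (by norm_num)
  have s3_pos : 0 < Real.sqrt 3 := Real.sqrt_pos.mpr (by norm_num)
  have s3_sq : Real.sqrt 3 ^ 2 = 3 := Real.sq_sqrt (by norm_num)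
  set k : ℤ := round (w 2 / hh) with hk
  set j : ℤ := round (w 1 / (Real.sqrt 3 / 2) - (k : ℝ) / 3) with hj
  set i : ℤ := round (w 0 - (j : ℝ) / 2 - (k : ℝ) / 2) with hi
  refine ⟨k, i, j, ?_⟩
  set p : E3 := barlowPos 1 hh constHagg k i j with hp
  have e0 : p 0 = (i : ℝ) + j / 2 + k / 2 := by
    rw [hp, barlowPos_apply_zero]; simp
  have e1 : p 1 = Real.sqrt 3 / 2 * ((j : ℝ) + k / 3) := by
    rw [hp, barlowPos_apply_one]; simp
  have e2 : p 2 = (k : ℝ) * hh := by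
    rw [hp, barlowPos_apply_two]
  have b0 : |w 0 - p 0| ≤ 1 / 2 := by
    rw [e0]
    have hr := abs_sub_round (w 0 - (j : ℝ) / 2 - (k : ℝ) / 2)
    rw [← hi] at hr
    calc |w 0 - ((i : ℝ) + j / 2 + k / 2)| = |w 0 - (j : ℝ) / 2 - (k : ℝ) / 2 - i| := by ring_nf
      _ ≤ 1 / 2 := hr
  have b1 : |w 1 - p 1| ≤ Real.sqrt 3 / 4 := by
    rw [e1]
    have hr := abs_sub_round (w 1 / (Real.sqrt 3 / 2) - (k : ℝ) / 3)
    rw [← hj] at hr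
    have : w 1 - Real.sqrt 3 / 2 * ((j : ℝ) + k / 3) =
        (Real.sqrt 3 / 2) * (w 1 / (Real.sqrt 3 / 2) - (k : ℝ) / 3 - j) := by
      field_simp
      ring
    rw [this, abs_mul, abs_of_pos (by positivity : (0 : ℝ) < Real.sqrt 3 / 2)]
    calc Real.sqrt 3 / 2 * |w 1 / (Real.sqrt 3 / 2) - (k : ℝ) / 3 - j|
        ≤ Real.sqrt 3 / 2 * (1 / 2) := by gcongr
      _ = Real.sqrt 3 / 4 := by ring
  have b2 : |w 2 - p 2| ≤ hh / 2 := by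
    rw [e2]
    have hr := abs_sub_round (w 2 / hh)
    rw [← hk] at hr
    have : w 2 - (k : ℝ) * hh = hh * (w 2 / hh - k) := by
      field_simp
    rw [this, abs_mul, abs_of_pos hh_pos]
    calc hh * |w 2 / hh - k| ≤ hh * (1 / 2) := by gcongr
      _ = hh / 2 := by ring
  have c0 : |w 0 - p 0| ^ 2 ≤ 1 / 4 := by
    calc |w 0 - p 0| ^ 2 ≤ (1 / 2) ^ 2 := pow_le_pow_left₀ (abs_nonneg _) b0 2
      _ = 1 / 4 := by norm_num
  have c1 : |w 1 - p 1| ^ 2 ≤ 3 / 16 := by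
    calc |w 1 - p 1| ^ 2 ≤ (Real.sqrt 3 / 4) ^ 2 := pow_le_pow_left₀ (abs_nonneg _) b1 2
      _ = 3 / 16 := by rw [div_pow, s3_sq]; norm_num
  have c2 : |w 2 - p 2| ^ 2 ≤ 1 / 6 := by
    calc |w 2 - p 2| ^ 2 ≤ (hh / 2) ^ 2 := pow_le_pow_left₀ (abs_nonneg _) b2 2
      _ = 1 / 6 := by rw [div_pow, hh_sq]; norm_num
  rw [EuclideanSpace.dist_eq, Fin.sum_univ_three]
  simp only [Real.dist_eq]
  rw [Real.sqrt_le_left (by norm_num : (0 : ℝ) ≤ 4 / 5)]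
  have h0 : |w.ofLp 0 - p.ofLp 0| ^ 2 ≤ 1 / 4 := c0
  have h1 : |w.ofLp 1 - p.ofLp 1| ^ 2 ≤ 3 / 16 := c1
  have h2 : |w.ofLp 2 - p.ofLp 2| ^ 2 ≤ 1 / 6 := c2
  linarith

/-- **`EquilibriumLocalisation` holds trivially** (second disjunct with `A = (1/160) • id`, `s = constHagg`):
the typed lemma is vacuous. -/
theorem equilibriumLocalisation_vacuous : EquilibriumLocalisation := by
  refine ⟨1, one_pos, fun r₀ _ S _ _ x _ _ _ => Or.inr ?_⟩
  refine ⟨(1 / 160 : ℝ) • ContinuousLinearMap.id ℝ E3, constHagg, isHaggSeq_const, fun y _ _ => ?_⟩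
  obtain ⟨k, i, j, hd⟩ := cover_fcc ((160 : ℝ) • (y - x))
  refine ⟨barlowPos 1 (Real.sqrt (2 / 3)) constHagg k i j, barlowPos_mem k i j, ?_⟩
  have hyx : y - x = (1 / 160 : ℝ) • ((160 : ℝ) • (y - x)) := by
    rw [smul_smul]; norm_num
  show dist (y - x) ((1 / 160 : ℝ) • barlowPos 1 (Real.sqrt (2 / 3)) constHagg k i j) ≤ 1 / 200
  rw [hyx, dist_smul₀]
  have hn : ‖(1 / 160 : ℝ)‖ = 1 / 160 := by
    rw [Real.norm_eq_abs, abs_of_pos (by norm_num)]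
  rw [hn]
  have hd0 : 0 ≤ dist ((160 : ℝ) • (y - x)) (barlowPos 1 (Real.sqrt (2 / 3)) constHagg k i j) := dist_nonneg
  linarith

#print axioms equilibriumLocalisation_vacuous

end TriageR22
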